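import Summits.BirchSwinnertonDyer.BirchSwinnertonDyer.Theorems.SignedLowerHalvesSprungLowerDivisibilityAtThreeIotaSharpOfFlat
import HarnessLib

/-!
# Crux `SprungLowerDivisibilityAtThree` (K1, item stmt-BirchSwinnertonDyer-19875), line `chromatic-common-zeros`:
# the PAIR FUNCTIONAL EQUATION of an X8 Sprung pair WITH ITS SIGN — `κ′(0) = σ` (the Fricke sign), `M₀₁ = 3T·unit`

Cell `bsd-ssimc` (host), width seat `cruxlead-stmt-BirchSwinnertonDyer-19875-w3` (gen 5) under the 19875 lead; `--supports`
19875 `--as helper`; theorems only; closes NO item (skeleton v8 unchanged). K1, BSD and leaf X8 are NOT proved by anything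
here. Companion of `…IotaSharpOfFlat` (p642065), whose `ClassX8.exists_pair_functionalEquation` exports `κ′` only as a unit;
the order-of-vanishing theorems of `…IotaOrderParity` need its constant term `κ′(0) = σ`:

* **`ClassX8.exists_pair_functionalEquation_sign`** — for every X8 pair `(W, 3)`, newform `f` with `f|W_N = −σf` (`σ = ±1`),
  Sprung pair `(L♯, L♭)`: `κ′, u, m₀₀, g, m₁₁ ∈ Λ` with `κ′(0) = σ`, `u ∈ Λˣ`, `m₀₀(0) = m₁₁(0) = 1`,
  `κ′·L♯(T^ι) = m₀₀·L♯ + C(3)·T·g·L♭` and `κ′·L♭(T^ι) = C(3)·T·u·L♯ + m₁₁·L♭` (`κ′ = (σ(1+T)^c)(T^ι)`, `c` the Teichmüller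
  exponent of the level). Class-wide, input-free (the trace-coordinate functional equation is the PROVED fact p621498; the
  transition matrix with `M₀₁ = 3T·unit` is p641447).

References: [Sprung2017] Thm. 1.1, §3.4 Prop. 3.14, Thm. 4.13, Cor. 4.4, Cor. 4.6, Cor. 4.14; [MazurTateTeitelbaum1986Invent] §I.17;
[GreenbergLNM1716] §1.
-/

set_option linter.dupNamespace false
set_option autoImplicit false

noncomputable section

open scoped Classical MatrixGroups ModularForm

open CongruenceSubgroup WeierstrassCurve Polynomial
  Literature.NumberTheory.EllipticCurves Literature.NumberTheory.EllipticCurves.ModularForms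
  Literature.NumberTheory.EllipticCurves.Sprung2017 Literature.NumberTheory.EllipticCurves.Rank1Residual
  Literature.Barriers.BirchSwinnertonDyer Summit.BirchSwinnertonDyer.Rank1Residual.Supersingular

namespace Summit.BirchSwinnertonDyer.BirchSwinnertonDyer.Theorems.ChromaticIota

/-! ## X8: the pair functional equation with its SIGN -/

section X8

/-- `ι ∘ ι = id` on `ℚ_3⟦T⟧` (private plumbing). [folklore] -/
private theorem subst_subst_rat₄ (g : PowerSeries ℚ_[3]) :
    PowerSeries.subst (invOnePlusSubOne : PowerSeries ℚ_[3])
      (PowerSeries.subst (invOnePlusSubOne : PowerSeries ℚ_[3]) g) = g := by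
  have hι := hasSubst_invOnePlusSubOne (R := ℚ_[3])
  rw [PowerSeries.subst_comp_subst_apply hι hι, invOnePlusSubOne_subst_self, PowerSeries.X_subst]

/-- `det ℒ(0) = 1/9 ≠ 0` (private plumbing). [cite: Sprung2017, §3.1 (ℒ(0) = C⁻²)] -/
private theorem det_halfLogMatrix_ne_zero₄ (b : ℤ) :
    halfLogMatrix b 0 0 * halfLogMatrix b 1 1 - halfLogMatrix b 0 1 * halfLogMatrix b 1 0 ≠ 0 := by
  intro h
  have h0 := congrArg PowerSeries.constantCoeff h
  rw [map_sub, map_mul, map_mul, constantCoeff_halfLogMatrix, constantCoeff_halfLogMatrix,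
    constantCoeff_halfLogMatrix, constantCoeff_halfLogMatrix, map_zero] at h0
  have hdetQ : (sprungCinv 3 (3 * b) ^ 2).det = 1 / 9 := by
    rw [Matrix.det_pow, Matrix.det_fin_two]
    simp [sprungCinv]
    norm_num
  have hcast : (((sprungCinv 3 (3 * b) ^ 2).det : ℚ) : ℚ_[3]) = 0 := by
    rw [Matrix.det_fin_two]
    push_cast
    linear_combination h0
  rw [hdetQ] at hcast
  norm_num at hcast

/-- A power series with all coefficients divisible by `3` and zero constant term is `C(3)·T·g` (private plumbing).
[folklore] -/
private theorem exists_eq_C_mul_X_mul_of_forall_dvd' {M : IwasawaAlgebra 3}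
    (h : ∀ j, (3 : ℤ_[3]) ∣ PowerSeries.coeff j M) (h0 : PowerSeries.constantCoeff M = 0) :
    ∃ g : IwasawaAlgebra 3, M = PowerSeries.C ((3 : ℕ) : ℤ_[3]) * PowerSeries.X * g := by
  choose g hg using h
  have hg0 : g 0 = 0 := by
    have h := hg 0
    rw [PowerSeries.coeff_zero_eq_constantCoeff_apply, h0] at h
    rcases mul_eq_zero.mp h.symm with h3 | h00
    · exact absurd h3 (by norm_num)
    · exact h00
  refine ⟨PowerSeries.mk fun j => g (j + 1), ?_⟩
  ext j
  rw [mul_assoc, PowerSeries.coeff_C_mul, hg j]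
  push_cast
  rcases j with _ | j
  · rw [PowerSeries.coeff_zero_X_mul, hg0, mul_zero]
  · rw [PowerSeries.coeff_succ_X_mul, PowerSeries.coeff_mk]

/-- **THE PAIR FUNCTIONAL EQUATION WITH ITS SIGN.** For every X8 pair `(W, 3)`, newform `f` with `f|W_N = −σf` (`σ = ±1`),
Sprung pair `(L♯, L♭)`: there are `κ′, u, m₀₀, g, m₁₁ ∈ Λ` with `κ′(0) = σ`, `u ∈ Λˣ`, `m₀₀(0) = m₁₁(0) = 1` and
`κ′·L♯(T^ι) = m₀₀·L♯ + C(3)·T·g·L♭`, `κ′·L♭(T^ι) = C(3)·T·u·L♯ + m₁₁·L♭` (`κ′ = (σ(1+T)^c)(T^ι)`).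
As `ClassX8.exists_pair_functionalEquation` (p642065), keeping the sign. [cite: Sprung2017, Thm. 1.1, Thm. 4.13, Cor. 4.14,
Prop. 3.14, Cor. 4.4 and Cor. 4.6] [cite: MazurTateTeitelbaum1986Invent, §I.17] [cite: GreenbergLNM1716, §1] -/
theorem ClassX8.exists_pair_functionalEquation_sign (W : WeierstrassCurve ℚ) [W.IsElliptic] [W.IsGloballyMinimal]
    (p : ℕ) [Fact p.Prime] (hX : ClassX8 W p) {N : ℕ} [hN : NeZero N] (f : CuspForm (Gamma0 N) 2)
    (hf : IsNewformOf W f) {σ : ℤ} (hσ : σ = 1 ∨ σ = -1) (hW : IsFrickeEigen N f (-(σ : ℂ)))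
    (Lsharp Lflat : IwasawaAlgebra p) (hSP : IsSprungPair f p (W.frobeniusTrace p) Lsharp Lflat) :
    ∃ κ' u m₀₀ g m₁₁ : IwasawaAlgebra p, PowerSeries.constantCoeff κ' = σ ∧ IsUnit u ∧
      PowerSeries.constantCoeff m₀₀ = 1 ∧ PowerSeries.constantCoeff m₁₁ = 1 ∧
      κ' * PowerSeries.subst (invOnePlusSubOne : IwasawaAlgebra p) Lsharp =
        m₀₀ * Lsharp + PowerSeries.C (p : ℤ_[p]) * PowerSeries.X * g * Lflat ∧
      κ' * PowerSeries.subst (invOnePlusSubOne : IwasawaAlgebra p) Lflat =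
        PowerSeries.C (p : ℤ_[p]) * PowerSeries.X * u * Lsharp + m₁₁ * Lflat := by
  obtain ⟨hp3, ⟨hgood, -⟩, -⟩ := id hX
  subst hp3
  haveI : NeZero N := hN
  have hσ2 : σ ^ 2 = 1 := by rcases hσ with rfl | rfl <;> norm_num
  -- `a_3 = 3b`, `b = ±1`, so `3 ∤ b`
  obtain ⟨b, hb, hab⟩ : ∃ b : ℤ, (b = 1 ∨ b = -1) ∧ W.frobeniusTrace 3 = 3 * b := by
    rcases ClassX8.frobeniusTrace_eq_three_or W 3 hX with h | h
    · exact ⟨1, Or.inl rfl, by rw [h]; norm_num⟩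
    · exact ⟨-1, Or.inr rfl, by rw [h]; norm_num⟩
  have hb3 : ¬ (3 : ℤ) ∣ b := by rcases hb with rfl | rfl <;> decide
  rw [hab] at hSP
  -- the Teichmüller exponent of the level (`3 ∤ N`)
  have hpN : ¬ 3 ∣ N := not_dvd_level_of_isNewformOf hf hgood
  obtain ⟨ηN, c, hc⟩ := exists_teichmuller_exponent_natCast (p := 3) hpN
  -- the functional equation of the trace coordinates (PROVED fact) and the refined integral transition matrix
  have hFE := thm413_traceCoordinate_functionalEquation_three_holds W N f b hb hf hgood hab σ hσ2 hW ηN c hc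
    invOnePlusSubOne one_add_X_mul_invOnePlusSubOne_add_one Lsharp Lflat hSP
  obtain ⟨M, ⟨u, hu, hM01⟩, hM10, hM00, hM11, hM10z, hM⟩ :=
    exists_integral_halfLogMatrix_offDiag_eq_C_mul_X_mul_unit b hb3
  -- cancelling `ℒ` in `ℚ_3⟦T⟧`
  have hι := hasSubst_invOnePlusSubOne (R := ℚ_[3])
  set τ : PowerSeries ℚ_[3] →+* PowerSeries ℚ_[3] := (PowerSeries.substAlgHom hι).toRingHom with hτ
  have hτapp : ∀ x : PowerSeries ℚ_[3], τ x = PowerSeries.subst (invOnePlusSubOne : PowerSeries ℚ_[3]) x :=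
    fun x => by rw [hτ, AlgHom.toRingHom_eq_coe, RingHom.coe_coe, PowerSeries.coe_substAlgHom]
  have hττ : ∀ x, τ (τ x) = x := fun x => by rw [hτapp, hτapp, subst_subst_rat₄]
  set κ : PowerSeries ℚ_[3] :=
    (σ : PowerSeries ℚ_[3]) * (PowerSeries.binomialSeries ℤ_[3] c).map (algebraMap ℤ_[3] ℚ_[3]) with hκ
  set L : Fin 2 → PowerSeries ℚ_[3] := ![iwasawaToPowerSeries 3 Lsharp, iwasawaToPowerSeries 3 Lflat] with hL
  have hL0 : L 0 = iwasawaToPowerSeries 3 Lsharp := rfl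
  have hL1 : L 1 = iwasawaToPowerSeries 3 Lflat := rfl
  have hFE' : ∀ k : Fin 2, τ (L 0 * halfLogMatrix b 0 k + L 1 * halfLogMatrix b 1 k) =
      κ * (L 0 * halfLogMatrix b 0 k + L 1 * halfLogMatrix b 1 k) := by
    intro k
    rw [hτapp, hL0, hL1]
    exact hFE k
  have hM' : ∀ i k : Fin 2, halfLogMatrix b i k =
      (M.map (iwasawaToPowerSeries 3)) i 0 * τ (halfLogMatrix b 0 k) +
        (M.map (iwasawaToPowerSeries 3)) i 1 * τ (halfLogMatrix b 1 k) := by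
    intro i k
    rw [Matrix.map_apply, Matrix.map_apply, hτapp, hτapp]
    exact hM i k
  have key := mul_map_eq_of_traceFE τ hττ L (halfLogMatrix b) (M.map (iwasawaToPowerSeries 3)) κ hFE' hM'
    (det_halfLogMatrix_ne_zero₄ b)
  -- pull back to `Λ`
  set κΛ : IwasawaAlgebra 3 := (σ : IwasawaAlgebra 3) * PowerSeries.binomialSeries ℤ_[3] c with hκΛ
  have hκι : κ = iwasawaToPowerSeries 3 κΛ := by rw [hκ, hκΛ, map_mul, map_intCast]
  have hκ0 : PowerSeries.constantCoeff (PowerSeries.subst (invOnePlusSubOne : IwasawaAlgebra 3) κΛ) = σ := by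
    rw [Literature.Barriers.BirchSwinnertonDyer.constantCoeff_subst_of_constantCoeff_eq_zero
      constantCoeff_invOnePlusSubOne, hκΛ, map_mul, map_intCast,
      PowerSeries.binomialSeries_constantCoeff, mul_one]
  have hpull : ∀ (Ll : IwasawaAlgebra 3) (m0 m1 : IwasawaAlgebra 3),
      τ κ * τ (iwasawaToPowerSeries 3 Ll) = iwasawaToPowerSeries 3 Lsharp * iwasawaToPowerSeries 3 m0 +
        iwasawaToPowerSeries 3 Lflat * iwasawaToPowerSeries 3 m1 →
      PowerSeries.subst (invOnePlusSubOne : IwasawaAlgebra 3) κΛ *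
          PowerSeries.subst (invOnePlusSubOne : IwasawaAlgebra 3) Ll = Lsharp * m0 + Lflat * m1 := by
    intro Ll m0 m1 h
    apply iwasawaToPowerSeries_injective 3
    rw [map_mul, map_add, map_mul, map_mul, iwasawaToPowerSeries_subst_invOnePlusSubOne,
      iwasawaToPowerSeries_subst_invOnePlusSubOne, ← hκι, ← hτapp, ← hτapp]
    exact h
  have hs : PowerSeries.subst (invOnePlusSubOne : IwasawaAlgebra 3) κΛ *
      PowerSeries.subst (invOnePlusSubOne : IwasawaAlgebra 3) Lsharp = Lsharp * M 0 0 + Lflat * M 1 0 := by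
    apply hpull
    have h := key 0
    rw [hL0, hL1, Matrix.map_apply, Matrix.map_apply] at h
    simpa using h
  have hfl : PowerSeries.subst (invOnePlusSubOne : IwasawaAlgebra 3) κΛ *
      PowerSeries.subst (invOnePlusSubOne : IwasawaAlgebra 3) Lflat = Lsharp * M 0 1 + Lflat * M 1 1 := by
    apply hpull
    have h := key 1
    rw [hL0, hL1, Matrix.map_apply, Matrix.map_apply] at h
    simpa using h
  obtain ⟨g, hg⟩ := exists_eq_C_mul_X_mul_of_forall_dvd' hM10 hM10z
  refine ⟨PowerSeries.subst (invOnePlusSubOne : IwasawaAlgebra 3) κΛ, u, M 0 0, g, M 1 1, hκ0, hu, hM00, hM11,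
    ?_, ?_⟩
  · rw [hs, hg]
    push_cast
    ring
  · rw [hfl, hM01]
    push_cast
    ring

end X8

end Summit.BirchSwinnertonDyer.BirchSwinnertonDyer.Theorems.ChromaticIota

end
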